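import Summits.CriticalPhenomena.PercolationContinuityZ3.Theorems.Transplant.SkelPhiCellsSmallMT
import Summits.CriticalPhenomena.PercolationContinuityZ3.Theorems.Transplant.SkelPhiRootRooms
import HarnessLib

/-!
(R-40) SUCCESSOR `…T` (hp-8 g42, 2026-08-23; ruling p3-g16 06:23:56Z, J18): the twin of `SkelPhiRootRoomsS` over the PER-AXIS creep cap `PCells2T` (PlanarCells2TDefs:
`c i ≤ r (oth i)` instead of the uniform `c i ≤ cmax ≤ r j`); statements and proofs VERBATIM with `PCells2S ↦ PCells2T` (+ the renames of record of the T layer below it);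
the only mathematical touch points are the places that read the cap, which only ever need the cross form `c (oth j) ≤ r j` (listed in the lane line of this file's landing).
NO landed file is edited; `SkelPhiRootRoomsS` stays valid (and is an instance of this file through `PCells2S.toT`). NON-VACUITY: inherited verbatim from `SkelPhiRootRoomsS` (same witness line).

# N2 (frames-only node `SamePDropOfSkeletonFrm₁`, OPEN), Γ ROWS (a), ROOT CELL: THE VERTEX-LEVEL ROOMS OF THE ROOT RUN AT THE STAGGERED SCHEME
# `cellGeomSG₂bT G ψ P t Λ b₀` — the `PCells2T` twin of p3's `SkelPhiRootRooms` (N1, R4) and `SkelPhiRootRoomsB` §2: FOOTPRINT conditions that put a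
# vertex of the root's ball into the root world `U0root du = Q_{0}(0) ∪ (Btw_{0}(0,du) ∪ Q_{0}(0+du))` (the `hreg` row of p3-g16's root legs
# `Skelφ.rootChainF_of_kgCorr/_Y`, SkelPhiRootLegKG) resp. into the small target box `M_{0}(0+du) = VWin ψ (cenS (0+du) ± b₀) (rM 0 (0+du))` (their `hlastM`).
At the root cell the staggered centre is `cenS 0 = 0`; the CHILD's centre is `cenS (0+du) = (20 r∥ σ along, σ·c∥ across)` (the stagger creep
`PCells2T.cenS_add_stepVec_oth`), and the arm of record `BtwNS 0 du` has transverse half-width `5r⊥ − 1 − c∥` ((R-29)).  So, with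
`λ := sgOf du · (ψ v)_{du.1}`: level `λ ∈ [−5r∥ + 1, 25r∥ − 1]` and `|(ψ v)_⊥| ≤ 5r⊥ − 2 − c∥` put `v ∈ B_G(t, R)` into `U0root du` once `R + 1 ≤` the
three radii (`Skelφ.mem_U0rootT_of_footprint`); `|λ − 20r∥| ≤ b₀∥ − 1`, `|(ψ v)_⊥ − σ c∥| ≤ b₀⊥ − 1` and `R + 1 ≤ rM 0 (0+du)` put it into `M_0(0+du)`
(`mem_rootMbT_of_footprint`).  The span neighbour is supplied by `WeakSteps` (`exists_adj_upBoxT/downBoxS`, SkelPhiCellsWeakGS); the span device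
`mem_VWin_of_adj_footprints` and `levels_of_adj` are p3's (SkelPhiRootRooms §1/§3, generic in `ψ`).
* §1 planar level forms at the root cell (namespace PCells2T): `mem_Q_zero_of_levelsS`, `mem_BtwNS_zero_of_levels`, `mem_Q_stepVec_of_levelsS`,
  `mem_Mb_stepVec_of_levelsS`;
* §2 the rooms: `mem_rootQT_of_footprint`, `mem_rootBtwT_of_footprint`, `mem_childQT_of_footprint`, **`mem_U0rootT_of_footprint`**, **`mem_rootMbT_of_footprint`**.
The radius rows `R + 1 ≤ rQ 0 0 / rB 0 0 du / rQ 0 (0+du) / rM 0 (0+du)` are stmt-g20's (b); the run-frame readings that produce the level/transverse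
margins from `runX u ∈ region k / last core` are p5's (c) (`fine_sub_ctr_mem_rd` at `ctr := cenS 0 = 0`, SkelPhiCorridorKGPrism).
builds on p205010 (kernel theorem, internal audit signed; external expert review pending) — nothing in this file uses p205010; nothing here is a
claim about the open node `SamePDropOfSkeletonFrm₁`.
Lane `prim-bschramm`, seat `prim-hp-8` (gen 40; Geom pen, lead g11 01:23:05Z (a), p3-g15 00:59:57Z (iii)); helper file (`--supports stmt-CriticalPhenomena-4575 --as helper`).
[cite: KozmaNitzan2024, §4 pp. 25–26 (Q_v, M_v, E_{v,x}), p. 28 ((32) at the root)] [cite: MartineauTassion2017, §4.1]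
-/

noncomputable section

open scoped Classical

namespace Summit.CriticalPhenomena.PercolationContinuityZ3.Theorems

namespace Transplant

open Literature.Probability.Percolation Literature.Probability.LatticeModels SimpleGraph GadgetSystem Contour KNCells
open Literature.Probability.Percolation.KozmaNitzan
open Literature.Probability.Percolation.KozmaNitzan.Cells (oth oth_ne sgOf sgOf_sign stepVec_apply_fst stepVec_apply_oth eq_oth_of_ne oth_oth)
open Literature.Barriers.CriticalPhenomena (graphBall mem_graphBall_self graphBall_mono)
open BoxProdZ2 (ConcRadiiG)
open PCells (mem_psBox_iff)

/-! ## §1 The planar boxes of the root world at the root cell `v = 0`, in level form (staggered child centre) -/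

namespace PCells2T

variable (P : PCells2T) (du : MDir)

/-- `Q 0` in level form: `|sgOf du · z_a| ≤ 5r∥` and `|z_⊥| ≤ 5r⊥` (`cenS 0 = 0`). [folklore] -/
theorem mem_Q_zero_of_levelsS {z : Site 2} (ha : |sgOf du * z du.1| ≤ 5 * (P.r du.1 : ℤ)) (hb : |z (oth du.1)| ≤ 5 * (P.r (oth du.1) : ℤ)) :
    z ∈ PCells2T.Q P 0 := by
  rw [Q, mem_aboxS_iff]
  intro i
  simp only [cenS_zero, Pi.zero_apply, zero_sub, zero_add, Nat.cast_mul, Nat.cast_ofNat]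
  have hσ := sgOf_sign du
  by_cases hi : i = du.1
  · subst hi
    rcases hσ with h | h <;> rw [h] at ha <;> [rw [one_mul] at ha; rw [neg_one_mul, abs_neg] at ha] <;> exact ⟨by linarith [(abs_le.1 ha).1], (abs_le.1 ha).2⟩
  · rw [eq_oth_of_ne hi]
    exact ⟨by linarith [(abs_le.1 hb).1], (abs_le.1 hb).2⟩

/-- `BtwNS 0 du` in level form: `5r∥ + 1 ≤ sgOf du · z_a ≤ 15r∥ − 1` and `|z_⊥| ≤ 5r⊥ − 1 − c∥` (the arm of record, narrowed by the creep).
[cite: KozmaNitzan2024, §4 p. 26 (E_{v,x})] -/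
theorem mem_BtwNS_zero_of_levels {z : Site 2} (ha₁ : 5 * ((P : PCells2T).r du.1 : ℤ) + 1 ≤ sgOf du * z du.1) (ha₂ : sgOf du * z du.1 ≤ 15 * (P.r du.1 : ℤ) - 1)
    (hb : |z (oth du.1)| ≤ 5 * (P.r (oth du.1) : ℤ) - 1 - P.c du.1) : z ∈ P.BtwNS 0 du := by
  rw [mem_BtwNS_iff]
  simp only [cenS_zero, Pi.zero_apply, sub_zero, zero_sub, zero_add]
  have h1 := (abs_le.1 hb).1
  have h2 := (abs_le.1 hb).2
  exact ⟨⟨ha₁, ha₂⟩, by linarith, by linarith⟩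

/-- `Q (0 + stepVec du)` in level form: `15r∥ ≤ sgOf du · z_a ≤ 25r∥` and `|z_⊥ − σ c∥| ≤ 5r⊥` (the child's cube sits about the STAGGERED centre
`(20 r∥ σ, σ c∥)`). [folklore] -/
theorem mem_Q_stepVec_of_levelsS {z : Site 2} (ha₁ : 15 * (P.r du.1 : ℤ) ≤ sgOf du * z du.1) (ha₂ : sgOf du * z du.1 ≤ 25 * (P.r du.1 : ℤ))
    (hb : |z (oth du.1) - sgOf du * P.c du.1| ≤ 5 * (P.r (oth du.1) : ℤ)) : z ∈ PCells2T.Q P ((0 : Site 2) + stepVec du) := by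
  rw [Q, mem_aboxS_iff]
  intro i
  push_cast
  have hσ := sgOf_sign du
  by_cases hi : i = du.1
  · subst hi
    rw [cenS_add_stepVec_fst, cenS_zero, Pi.zero_apply, zero_add]
    rcases hσ with h | h <;> rw [h] at ha₁ ha₂ ⊢ <;> constructor <;> linarith
  · rw [eq_oth_of_ne hi, cenS_add_stepVec_oth, cenS_zero, Pi.zero_apply, zero_add]
    exact ⟨by linarith [(abs_le.1 hb).1], by linarith [(abs_le.1 hb).2]⟩

/-- `Mb b₀ (0 + stepVec du)` in level form: `|sgOf du · z_a − 20r∥| ≤ b₀∥` and `|z_⊥ − σ c∥| ≤ b₀⊥`. [folklore] -/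
theorem mem_Mb_stepVec_of_levelsS {b₀ : Fin 2 → ℕ} {z : Site 2} (ha : |sgOf du * z du.1 - 20 * (P.r du.1 : ℤ)| ≤ b₀ du.1)
    (hb : |z (oth du.1) - sgOf du * P.c du.1| ≤ b₀ (oth du.1)) : z ∈ PCells2T.Mb P b₀ ((0 : Site 2) + stepVec du) := by
  rw [mem_Mb_iff]
  intro i
  have hσ := sgOf_sign du
  by_cases hi : i = du.1
  · subst hi
    rw [cenS_add_stepVec_fst, cenS_zero, Pi.zero_apply, zero_add]
    have h1 := (abs_le.1 ha).1
    have h2 := (abs_le.1 ha).2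
    rcases hσ with h | h <;> rw [h] at h1 h2 ⊢ <;> constructor <;> linarith
  · rw [eq_oth_of_ne hi, cenS_add_stepVec_oth, cenS_zero, Pi.zero_apply, zero_add]
    exact ⟨by linarith [(abs_le.1 hb).1], by linarith [(abs_le.1 hb).2]⟩

end PCells2T

/-! ## §2 The rooms at the staggered scheme of record -/

namespace Skelφ

open PlanarSkeletonConc (mem_vspan_edgesIn_of_adj)

variable {V : Type} [DecidableEq V] {G : SimpleGraph V} [G.LocallyFinite] {ψ : V → Site 2}

section Rooms

variable (P : PCells2T) (t : V) (Λ : ConcRadiiG) (b₀ : Fin 2 → ℕ) (q : unitInterval) (δc : ℝ) (du : MDir)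

/-- **ROOM 1: the root cube.**  A vertex of depth `≤ R` whose footprint has level `∈ [−5r∥ + 1, 5r∥]` and transverse coordinate `≤ 5r⊥ − 1` in
absolute value lies in `Q_0(0)` (`R + 1 ≤ rQ 0 0`; span neighbour one level DOWN-or-equal). [cite: KozmaNitzan2024, §4 p. 26 (Q_v)] -/
theorem mem_rootQT_of_footprint (hlip : Lip G ψ) (hws : WeakSteps G ψ) {R : ℕ} (hR : R + 1 ≤ Λ.rQ 0 0) {v : V} (hv : v ∈ graphBall G t R)
    (h₁ : -(5 * (P.r du.1 : ℤ)) + 1 ≤ sgOf du * ψ v du.1) (h₂ : sgOf du * ψ v du.1 ≤ 5 * (P.r du.1 : ℤ))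
    (hb : |ψ v (oth du.1)| ≤ 5 * (P.r (oth du.1) : ℤ) - 1) :
    v ∈ (cellGeomSG₂bT G ψ P t Λ b₀).Q 0 0 := by
  obtain ⟨m, hadj, hml, hml', hmt⟩ := exists_adj_downBoxT hlip hws P du 0 v
  simp only [PCells2T.lev_def, PCells2T.cenS_zero, Pi.zero_apply, sub_zero] at hml hml'
  change v ∈ VWin G ψ t (PCells2T.Q P 0) (Λ.rQ 0 0)
  refine mem_VWin_of_adj_footprints hv hR hadj ?_ ?_
  · exact PCells2T.mem_Q_zero_of_levelsS P du (abs_le.2 ⟨by linarith, h₂⟩)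
      (by have := (abs_le.1 hb); exact abs_le.2 ⟨by linarith [this.1], by linarith [this.2]⟩)
  · refine PCells2T.mem_Q_zero_of_levelsS P du (abs_le.2 ⟨by linarith, by linarith⟩) ?_
    have h1 := (abs_le.1 hb); have h2 := (abs_le.1 hmt)
    exact abs_le.2 ⟨by linarith [h1.1, h2.1], by linarith [h1.2, h2.2]⟩

/-- **ROOM 2: the arm of record.**  Level `∈ [5r∥ + 1, 15r∥ − 1]`, transverse `≤ 5r⊥ − 2 − c∥`, `R + 1 ≤ rB 0 0 du` ⟹ `v ∈ Btw_0(0, du)` (span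
neighbour one level up-or-equal, or down-or-equal at the far end). [cite: KozmaNitzan2024, §4 p. 26 (E_{v,x})] -/
theorem mem_rootBtwT_of_footprint (hlip : Lip G ψ) (hws : WeakSteps G ψ) {R : ℕ} (hR : R + 1 ≤ Λ.rB 0 0 du) {v : V} (hv : v ∈ graphBall G t R)
    (h₁ : 5 * (P.r du.1 : ℤ) + 1 ≤ sgOf du * ψ v du.1) (h₂ : sgOf du * ψ v du.1 ≤ 15 * (P.r du.1 : ℤ) - 1)
    (hb : |ψ v (oth du.1)| ≤ 5 * (P.r (oth du.1) : ℤ) - 2 - P.c du.1) :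
    v ∈ (cellGeomSG₂bT G ψ P t Λ b₀).Btw 0 0 du := by
  change v ∈ VWin G ψ t (P.BtwNS 0 du) (Λ.rB 0 0 du)
  have hr : (1 : ℤ) ≤ P.r du.1 := by exact_mod_cast P.one_le_r du.1
  have hbv : |ψ v (oth du.1)| ≤ 5 * (P.r (oth du.1) : ℤ) - 1 - P.c du.1 := hb.trans (by linarith)
  by_cases hfar : sgOf du * ψ v du.1 ≤ 15 * (P.r du.1 : ℤ) - 2
  · obtain ⟨m, hadj, hml, hml', hmt⟩ := exists_adj_upBoxT hlip hws P du 0 v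
    simp only [PCells2T.lev_def, PCells2T.cenS_zero, Pi.zero_apply, sub_zero] at hml hml'
    refine mem_VWin_of_adj_footprints hv hR hadj (PCells2T.mem_BtwNS_zero_of_levels P du h₁ h₂ hbv)
      (PCells2T.mem_BtwNS_zero_of_levels P du (by linarith) (by linarith) ?_)
    have h1 := (abs_le.1 hb); have h2 := (abs_le.1 hmt)
    exact abs_le.2 ⟨by linarith [h1.1, h2.1], by linarith [h1.2, h2.2]⟩
  · obtain ⟨m, hadj, hml, hml', hmt⟩ := exists_adj_downBoxT hlip hws P du 0 v
    simp only [PCells2T.lev_def, PCells2T.cenS_zero, Pi.zero_apply, sub_zero] at hml hml'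
    refine mem_VWin_of_adj_footprints hv hR hadj (PCells2T.mem_BtwNS_zero_of_levels P du h₁ h₂ hbv)
      (PCells2T.mem_BtwNS_zero_of_levels P du (by linarith) (by linarith) ?_)
    have h1 := (abs_le.1 hb); have h2 := (abs_le.1 hmt)
    exact abs_le.2 ⟨by linarith [h1.1, h2.1], by linarith [h1.2, h2.2]⟩

/-- **ROOM 3: the child's cube** about the staggered centre.  Level `∈ [15r∥, 25r∥ − 1]`, transverse `|(ψ v)_⊥ − σ c∥| ≤ 5r⊥ − 1`,
`R + 1 ≤ rQ 0 (0 + du)` ⟹ `v ∈ Q_0(0 + du)`. [cite: KozmaNitzan2024, §4 p. 26 (Q_v)] -/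
theorem mem_childQT_of_footprint (hlip : Lip G ψ) (hws : WeakSteps G ψ) {R : ℕ} (hR : R + 1 ≤ Λ.rQ 0 ((0 : Site 2) + stepVec du)) {v : V}
    (hv : v ∈ graphBall G t R) (h₁ : 15 * (P.r du.1 : ℤ) ≤ sgOf du * ψ v du.1) (h₂ : sgOf du * ψ v du.1 ≤ 25 * (P.r du.1 : ℤ) - 1)
    (hb : |ψ v (oth du.1) - sgOf du * P.c du.1| ≤ 5 * (P.r (oth du.1) : ℤ) - 1) :
    v ∈ (cellGeomSG₂bT G ψ P t Λ b₀).Q 0 ((0 : Site 2) + stepVec du) := by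
  change v ∈ VWin G ψ t (PCells2T.Q P ((0 : Site 2) + stepVec du)) (Λ.rQ 0 ((0 : Site 2) + stepVec du))
  obtain ⟨m, hadj, hml, hml', hmt⟩ := exists_adj_upBoxT hlip hws P du 0 v
  simp only [PCells2T.lev_def, PCells2T.cenS_zero, Pi.zero_apply, sub_zero] at hml hml'
  refine mem_VWin_of_adj_footprints hv hR hadj (PCells2T.mem_Q_stepVec_of_levelsS P du h₁ (by linarith) (hb.trans (by linarith)))
    (PCells2T.mem_Q_stepVec_of_levelsS P du (by linarith) (by linarith) ?_)
  have h1 := (abs_le.1 hb); have h2 := (abs_le.1 hmt)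
  exact abs_le.2 ⟨by linarith [h1.1, h2.1], by linarith [h1.2, h2.2]⟩

/-- **THE ROOT WORLD FROM A FOOTPRINT** (staggered scheme): a vertex of depth `≤ R` whose footprint has level `∈ [−5r∥ + 1, 25r∥ − 1]` and
transverse coordinate `≤ 5r⊥ − 2 − c∥` lies in the root world `U0root du = Q_0(0) ∪ (Btw_0(0,du) ∪ Q_0(0+du))` of the scheme
`⟨cellGeomSG₂bT G ψ P t Λ b₀, q, δc⟩`, provided `R + 1 ≤ rQ 0 0, rB 0 0 du, rQ 0 (0+du)` — the `hreg` row of the root legs.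
[cite: KozmaNitzan2024, §4 p. 28 ((32) at the root: the world Q₀ ∪ E_{0,v})] -/
theorem mem_U0rootT_of_footprint (hlip : Lip G ψ) (hws : WeakSteps G ψ) {R : ℕ} (hRQ : R + 1 ≤ Λ.rQ 0 0) (hRB : R + 1 ≤ Λ.rB 0 0 du)
    (hRQ' : R + 1 ≤ Λ.rQ 0 ((0 : Site 2) + stepVec du)) {v : V} (hv : v ∈ graphBall G t R)
    (h₁ : -(5 * (P.r du.1 : ℤ)) + 1 ≤ sgOf du * ψ v du.1) (h₂ : sgOf du * ψ v du.1 ≤ 25 * (P.r du.1 : ℤ) - 1)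
    (hb : |ψ v (oth du.1)| ≤ 5 * (P.r (oth du.1) : ℤ) - 2 - P.c du.1) :
    v ∈ (⟨cellGeomSG₂bT G ψ P t Λ b₀, q, δc⟩ : KSchA V ℕ).U0root du := by
  rw [KSchA.U0root, CellGeom.Ewv]
  change v ∈ (cellGeomSG₂bT G ψ P t Λ b₀).Q 0 0 ∪
    ((cellGeomSG₂bT G ψ P t Λ b₀).Btw 0 0 du ∪ (cellGeomSG₂bT G ψ P t Λ b₀).Q 0 ((0 : Site 2) + stepVec du))
  have hc := P.c_nonneg du.1
  have hcs : |sgOf du * P.c du.1| = P.c du.1 := by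
    rcases sgOf_sign du with h | h <;> rw [h] <;> simp [abs_of_nonneg hc]
  by_cases hQ : sgOf du * ψ v du.1 ≤ 5 * (P.r du.1 : ℤ)
  · exact Finset.mem_union_left _ (mem_rootQT_of_footprint P t Λ b₀ du hlip hws hRQ hv h₁ hQ (hb.trans (by linarith)))
  · by_cases hB : sgOf du * ψ v du.1 ≤ 15 * (P.r du.1 : ℤ) - 1
    · exact Finset.mem_union_right _ (Finset.mem_union_left _ (mem_rootBtwT_of_footprint P t Λ b₀ du hlip hws hRB hv (by linarith) hB hb))
    · refine Finset.mem_union_right _ (Finset.mem_union_right _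
        (mem_childQT_of_footprint P t Λ b₀ du hlip hws hRQ' hv (by linarith) h₂ ?_))
      calc |ψ v (oth du.1) - sgOf du * P.c du.1| ≤ |ψ v (oth du.1)| + |sgOf du * P.c du.1| := abs_sub _ _
        _ ≤ _ := by rw [hcs]; linarith

/-- **THE SMALL TARGET BOX FROM A FOOTPRINT** (staggered scheme): level within `b₀∥ − 1` of `20r∥`, transverse `|(ψ v)_⊥ − σ c∥| ≤ b₀⊥ − 1`,
depth `≤ R`, `R + 1 ≤ rM 0 (0+du)` ⟹ `v ∈ M_0(0 + du) = VWin ψ (cenS (0+du) ± b₀) (rM 0 (0+du))` — the `hlastM` row of the root legs.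
[cite: KozmaNitzan2024, §4 p. 26 (M_v)] -/
theorem mem_rootMbT_of_footprint (hlip : Lip G ψ) (hws : WeakSteps G ψ) {R : ℕ} (hR : R + 1 ≤ Λ.rM 0 ((0 : Site 2) + stepVec du)) {v : V}
    (hv : v ∈ graphBall G t R) (ha : |sgOf du * ψ v du.1 - 20 * (P.r du.1 : ℤ)| ≤ (b₀ du.1 : ℤ) - 1)
    (hb : |ψ v (oth du.1) - sgOf du * P.c du.1| ≤ (b₀ (oth du.1) : ℤ) - 1) :
    v ∈ (cellGeomSG₂bT G ψ P t Λ b₀).M 0 ((0 : Site 2) + stepVec du) := by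
  rw [cellGeomSG₂bT_M]
  obtain ⟨m, hadj, -, -, -⟩ := exists_adj_upBoxT hlip hws P du 0 v
  obtain ⟨hl, ht⟩ := levels_of_adj du hlip hadj
  refine mem_VWin_of_adj_footprints hv hR hadj (PCells2T.mem_Mb_stepVec_of_levelsS P du (ha.trans (by linarith)) (hb.trans (by linarith)))
    (PCells2T.mem_Mb_stepVec_of_levelsS P du ?_ ?_)
  · have h1 := abs_le.1 ha; have h2 := abs_le.1 hl
    exact abs_le.2 ⟨by linarith [h1.1, h2.1], by linarith [h1.2, h2.2]⟩
  · have h1 := abs_le.1 hb; have h2 := abs_le.1 ht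
    exact abs_le.2 ⟨by linarith [h1.1, h2.1], by linarith [h1.2, h2.2]⟩

end Rooms

end Skelφ

end Transplant

end Summit.CriticalPhenomena.PercolationContinuityZ3.Theorems

end
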